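import Summits.QuantumFields.QCD.Theorems.SpectralDefectExtinctionWindowExtinctionChessboardOddCycle
import Summits.QuantumFields.QCD.Theorems.SpectralDefectExtinctionWindowExtinctionChessboardFlatCubeEvent
import Literature.MathematicalPhysics.QuantumFieldTheory.ConstructiveQFTWave0OddRPProofs
import Literature.MathematicalPhysics.QuantumFieldTheory.LatticeGaugeProofs
import HarnessLib

/-!
# Crux `LatticeGapOnTrajectory` (stmt-QuantumFields-10523), line `sparse-defect-orbit-window`:
# support file for stub (B) `stub_tiltChessboardStep` — tilt functionals of one orientation
# class on the odd four-torus and their reflection Schwarz inequality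

With `Ψ(e) := E_β exp(-∑ₓ e(x) Re tr ρ(U_{(x,o)}))` for a tilt profile `e` on the sites of the
torus `(ℤ/L)^d` and a fixed plane `o` we record: behaviour of the exponent under the time
reflection `Θ` (the profile is composed with the site part `r` of the plaquette reflection) and
under torus translations (translation invariance of `Ψ`), measurability, bounds, integrability,
the product rule `exp(-∑ e₁ f) exp(-∑ e₂ f) = exp(-∑ (e₁ + e₂) f)`, and locality: on the odd torus
`(ℤ/(2S+1))⁴` a profile supported on the kept layers `1 ≤ x₀ ≤ S` (and `x₀ = S + 1` for a
spatial plane) gives an observable of the links `P ∪ M` of odd-torus reflection positivity.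

Main result `schwarz_profiles`: odd-torus Osterwalder–Seiler positivity with a crossing tilt
(hypothesis (A) of the line, taken as an assumption) tested on the two-term observable
`a Ψ_{eP} + b Ψ_{eQ}` gives the reflection Schwarz inequality
`Ψ(eQ ∘ r + eP + w)² ≤ Ψ(eP ∘ r + eP + w) Ψ(eQ ∘ r + eQ + w)` (symmetry of the form from the test
vector `(1, i)`, discriminant from `(x, -1)`).
-/

set_option autoImplicit false

noncomputable section

namespace Summit.QuantumFields.YangMills.Cruxes.LatticeGapOnTrajectory.SparseDefectOrbitWindow

open scoped BigOperators ENNReal ComplexOrder ComplexConjugate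
open MeasureTheory Literature.MathematicalPhysics.QuantumFieldTheory
open Summit.QuantumFields.QCD.Cruxes.WindowExtinction.ChessboardColdCells

/-! ## §1  Generic facts about the tilt functionals `exp(-∑ₓ e(x) Re tr ρ(U_{(x,o)}))` -/

section Generic

variable {d L N : ℕ} [NeZero d] [NeZero L]
variable {G : Type} [Group G] [TopologicalSpace G] [IsTopologicalGroup G] [CompactSpace G]
  [MeasurableSpace G] [BorelSpace G]
variable (ρ : G →* Matrix (Fin N) (Fin N) ℂ) (o : {q : Fin d × Fin d // q.1 < q.2})

omit [NeZero L] in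
/-- The site part of the plaquette reflection is an involution. -/
theorem plaqReflect_fst_involutive :
    Function.Involutive fun x : Site d L => (WilsonRP.plaqReflect (x, o)).1 := by
  intro x
  have h := WilsonRP.plaqReflect_plaqReflect (x, o)
  have h2 : WilsonRP.plaqReflect (x, o) = ((WilsonRP.plaqReflect (x, o)).1, o) := rfl
  rw [h2] at h
  exact congrArg Prod.fst h

omit [MeasurableSpace G] [BorelSpace G] in
/-- Reflecting the configuration reflects the tilt profile. -/
theorem sum_plaqRe_timeReflect (hρ : Continuous ρ) (e : Site d L → ℝ) (U : GaugeConfig d L G) :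
    ∑ x, e x * WilsonRP.plaqRe ρ U.timeReflect (x, o) =
      ∑ x, e (WilsonRP.plaqReflect (x, o)).1 * WilsonRP.plaqRe ρ U (x, o) := by
  have hinv := plaqReflect_fst_involutive (L := L) o
  simp_rw [WilsonRP.plaqRe_timeReflect ρ hρ]
  refine Fintype.sum_equiv (hinv.toPerm _) _ _ fun x => ?_
  have hx := hinv x
  beta_reduce at hx
  rw [Function.Involutive.coe_toPerm]
  show e x * WilsonRP.plaqRe ρ U (WilsonRP.plaqReflect (x, o)) =
    e (WilsonRP.plaqReflect ((WilsonRP.plaqReflect (x, o)).1, o)).1 *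
      WilsonRP.plaqRe ρ U (WilsonRP.plaqReflect (x, o))
  rw [hx]

omit [NeZero d] [TopologicalSpace G] [IsTopologicalGroup G] [CompactSpace G] [BorelSpace G] in
/-- Translating the configuration translates the tilt profile. -/
theorem sum_plaqRe_torusConfigShift (e : Site d L → ℝ) (v : Site d L) (U : GaugeConfig d L G) :
    ∑ x, e x * WilsonRP.plaqRe ρ (torusConfigShift v U) (x, o) =
      ∑ x, e (x + v) * WilsonRP.plaqRe ρ U (x, o) := by
  simp only [WilsonRP.plaqRe, plaquetteHolonomy_torusConfigShift]
  exact Fintype.sum_equiv (Equiv.subRight v) _ _ fun x => by simp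

omit [NeZero d] in
/-- **Translation invariance** of the tilt functionals (translation invariance of the Wilson
measure). -/
theorem integral_exp_sum_shift (β : ℝ) (e : Site d L → ℝ) (v : Site d L) :
    ∫ U, Real.exp (-∑ x, e (x + v) * WilsonRP.plaqRe ρ U (x, o))
        ∂(wilsonMeasure ρ β : Measure (GaugeConfig d L G)) =
      ∫ U, Real.exp (-∑ x, e x * WilsonRP.plaqRe ρ U (x, o))
        ∂(wilsonMeasure ρ β : Measure (GaugeConfig d L G)) := by
  simp_rw [← sum_plaqRe_torusConfigShift ρ o e v]
  rw [← integral_map_equiv (torusConfigShift v)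
    (fun U : GaugeConfig d L G => Real.exp (-∑ x, e x * WilsonRP.plaqRe ρ U (x, o))),
    wilsonMeasure_map_torusConfigShift]

/-- Products of tilt functionals add the profiles. -/
theorem exp_sum_mul_exp_sum {ι : Type*} [Fintype ι] (e₁ e₂ f : ι → ℝ) :
    Real.exp (-∑ x, e₁ x * f x) * Real.exp (-∑ x, e₂ x * f x) =
      Real.exp (-∑ x, (e₁ x + e₂ x) * f x) := by
  rw [← Real.exp_add]
  congr 1
  simp only [add_mul, Finset.sum_add_distrib]
  ring

omit [NeZero d] [CompactSpace G] in
/-- The tilt functionals are measurable. -/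
theorem measurable_exp_sum (hρ : Continuous ρ) (e : Site d L → ℝ) :
    Measurable fun U : GaugeConfig d L G =>
      Real.exp (-∑ x, e x * WilsonRP.plaqRe ρ U (x, o)) :=
  (Finset.measurable_sum _ fun _ _ => (WilsonRP.measurable_plaqRe ρ hρ _).const_mul _).neg.exp

omit [NeZero d] [MeasurableSpace G] [BorelSpace G] in
/-- The tilt functionals are bounded. -/
theorem exp_sum_le (hρ : Continuous ρ) (e : Site d L → ℝ) (U : GaugeConfig d L G) :
    Real.exp (-∑ x, e x * WilsonRP.plaqRe ρ U (x, o)) ≤ Real.exp (∑ x, |e x| * N) := by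
  refine Real.exp_le_exp.2 ((neg_le_abs _).trans ((Finset.abs_sum_le_sum_abs _ _).trans
    (Finset.sum_le_sum fun x _ => ?_)))
  rw [abs_mul]
  exact mul_le_mul_of_nonneg_left (WilsonRP.abs_plaqRe_le ρ hρ U _) (abs_nonneg _)

omit [NeZero d] in
/-- The tilt functionals (cast to `ℂ`) are integrable for the Wilson measure. -/
theorem integrable_exp_sum (hρ : Continuous ρ) (β : ℝ) (e : Site d L → ℝ) :
    Integrable (fun U : GaugeConfig d L G =>
      ((Real.exp (-∑ x, e x * WilsonRP.plaqRe ρ U (x, o)) : ℝ) : ℂ))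
      (wilsonMeasure ρ β : Measure (GaugeConfig d L G)) := by
  haveI := isProbabilityMeasure_wilsonMeasure (d := d) (L := L) ρ hρ β
  refine Integrable.of_bound
    (Complex.measurable_ofReal.comp (measurable_exp_sum ρ o hρ e)).aestronglyMeasurable
    (Real.exp (∑ x, |e x| * N)) (ae_of_all _ fun U => ?_)
  rw [Complex.norm_of_nonneg (Real.exp_pos _).le]
  exact exp_sum_le ρ o hρ e U

omit [TopologicalSpace G] [IsTopologicalGroup G] [CompactSpace G] [MeasurableSpace G]
  [BorelSpace G] in
/-- The crossing tilt of (A), restricted to one orientation, is a tilt functional of a profile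
supported on the crossing sites. -/
theorem sum_cross_tilt (w : Site d L → ℝ) (hw : ∀ x, w x ≠ 0 → WilsonOddRP.IsOCrossPlaq (x, o))
    (U : GaugeConfig d L G) :
    ∑ p ∈ Finset.univ.filter WilsonOddRP.IsOCrossPlaq,
        (if p.2 = o then w p.1 else 0) * WilsonRP.plaqRe ρ U p =
      ∑ x, w x * WilsonRP.plaqRe ρ U (x, o) := by
  rw [Finset.sum_filter, Fintype.sum_prod_type]
  refine Finset.sum_congr rfl fun x _ => ?_
  rw [Finset.sum_eq_single o]
  · simp only [if_true]
    by_cases hx : w x = 0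
    · simp [hx]
    · rw [if_pos (hw x hx)]
  · intro q _ hq
    simp [hq]
  · simp

/-- **The quadratic-form step**: a Hermitian-type form with real entries which is non-negative on
`ℂ²` has `c² ≤ p m` (symmetry from the test vector `(1, i)`, discriminant from `(x, -1)`). -/
theorem sq_le_mul_of_form {p c c' m : ℝ}
    (h : ∀ a b : ℂ, 0 ≤ conj a * a * (p : ℂ) + conj b * a * (c : ℂ) + conj a * b * (c' : ℂ) +
      conj b * b * (m : ℂ)) :
    c ^ 2 ≤ p * m := by
  have hsymm : c' = c := by
    have h := (Complex.le_def.1 (h 1 Complex.I)).2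
    simp at h
    linarith
  have hquad : ∀ x : ℝ, 0 ≤ p * (x * x) + (-(2 * c)) * x + m := by
    intro x
    have h := (Complex.le_def.1 (h x (-1))).1
    simp at h
    rw [hsymm] at h
    linarith
  have hd := discrim_le_zero hquad
  rw [discrim] at hd
  nlinarith [hd]

end Generic

/-! ## §2  The odd four-torus: kept layers, and the reflection Schwarz inequality from (A) -/

section Torus

variable {S N : ℕ} {G : Type} [Group G] [TopologicalSpace G] [IsTopologicalGroup G]
  [CompactSpace G] [MeasurableSpace G] [BorelSpace G]
variable (ρ : G →* Matrix (Fin N) (Fin N) ℂ) (o : {q : Fin 4 × Fin 4 // q.1 < q.2})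

/-- **Kept layers.** The four links of the plaquette `(x, o)` are positive or shared links of the
odd torus (`P ∪ M`) when `1 ≤ x₀ ≤ S`, and also when `x₀ = S + 1` for a spatial plane `o`. -/
theorem edges_mem (hS : 1 ≤ S) (x : Site 4 (2 * S + 1))
    (hx : (1 ≤ (x 0).val ∧ (x 0).val ≤ S) ∨ (o.1.1 ≠ 0 ∧ (x 0).val = S + 1)) :
    (x, o.1.1) ∈ (WilsonOddRP.oPosEdges ∪ WilsonOddRP.oSharedEdges : Finset (Edge 4 (2 * S + 1))) ∧
    (x.shift o.1.1, o.1.2) ∈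
      (WilsonOddRP.oPosEdges ∪ WilsonOddRP.oSharedEdges : Finset (Edge 4 (2 * S + 1))) ∧
    (x.shift o.1.2, o.1.1) ∈
      (WilsonOddRP.oPosEdges ∪ WilsonOddRP.oSharedEdges : Finset (Edge 4 (2 * S + 1))) ∧
    (x, o.1.2) ∈ (WilsonOddRP.oPosEdges ∪ WilsonOddRP.oSharedEdges : Finset (Edge 4 (2 * S + 1))) := by
  haveI : Fact (1 < 2 * S + 1) := ⟨by omega⟩
  obtain ⟨⟨i, j⟩, hij⟩ := o
  have hj : j ≠ 0 := WilsonRP.plaq_snd_ne_zero (x, ⟨(i, j), hij⟩)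
  have hdiv : (2 * S + 1) / 2 = S := by omega
  have hlt := ZMod.val_lt (x 0)
  simp only [Finset.mem_union, WilsonOddRP.mem_oPosEdges, WilsonOddRP.mem_oSharedEdges,
    WilsonOddRP.IsOPosEdge, WilsonOddRP.IsOSharedEdge, hdiv] at hx ⊢
  by_cases hi : i = 0
  · subst hi
    have hx' : 1 ≤ (x 0).val ∧ (x 0).val ≤ S := by
      rcases hx with hx | hx
      · exact hx
      · exact absurd rfl hx.1
    have h0 : ((x.shift 0) 0).val = (x 0).val + 1 := by
      rw [WilsonRP.val_shift_self, if_neg (by omega)]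
    have h1 : ((x.shift j) 0).val = (x 0).val := WilsonRP.val_shift_of_ne _ hj.symm
    refine ⟨Or.inl hx', ?_, Or.inl (by rw [h1]; exact hx'), Or.inl hx'⟩
    by_cases hv : (x 0).val + 1 ≤ S
    · exact Or.inl (by rw [h0]; exact ⟨by omega, hv⟩)
    · exact Or.inr ⟨hj, by rw [h0]; omega⟩
  · have h0 : ((x.shift i) 0).val = (x 0).val := WilsonRP.val_shift_of_ne _ (Ne.symm hi)
    have h1 : ((x.shift j) 0).val = (x 0).val := WilsonRP.val_shift_of_ne _ hj.symm
    rcases hx with hx | hx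
    · exact ⟨Or.inl hx, Or.inl (by rw [h0]; exact hx), Or.inl (by rw [h1]; exact hx), Or.inl hx⟩
    · exact ⟨Or.inr ⟨hi, hx.2⟩, Or.inr ⟨hj, by rw [h0]; exact hx.2⟩,
        Or.inr ⟨hi, by rw [h1]; exact hx.2⟩, Or.inr ⟨hj, hx.2⟩⟩

omit [TopologicalSpace G] [IsTopologicalGroup G] [CompactSpace G] [MeasurableSpace G]
  [BorelSpace G] in
/-- A tilt functional whose profile lives on the kept layers depends only on the links of
`P ∪ M`. -/
theorem exp_sum_congr (hS : 1 ≤ S) (e : Site 4 (2 * S + 1) → ℝ)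
    (he : ∀ x, e x ≠ 0 → (1 ≤ (x 0).val ∧ (x 0).val ≤ S) ∨ (o.1.1 ≠ 0 ∧ (x 0).val = S + 1))
    {U V : GaugeConfig 4 (2 * S + 1) G}
    (hUV : ∀ q ∈ ((WilsonOddRP.oPosEdges ∪ WilsonOddRP.oSharedEdges :
      Finset (Edge 4 (2 * S + 1))) : Set (Edge 4 (2 * S + 1))), U q = V q) :
    Real.exp (-∑ x, e x * WilsonRP.plaqRe ρ U (x, o)) =
      Real.exp (-∑ x, e x * WilsonRP.plaqRe ρ V (x, o)) := by
  congr 2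
  refine Finset.sum_congr rfl fun x _ => ?_
  by_cases hx : e x = 0
  · rw [hx, zero_mul, zero_mul]
  · obtain ⟨h1, h2, h3, h4⟩ := edges_mem o hS x (he x hx)
    simp only [WilsonRP.plaqRe, plaquetteHolonomy, hUV _ (Finset.mem_coe.2 h1),
      hUV _ (Finset.mem_coe.2 h2), hUV _ (Finset.mem_coe.2 h3), hUV _ (Finset.mem_coe.2 h4)]

end Torus

/-- **Reflection Schwarz inequality for tilt functionals**, from odd-torus reflection positivity
with a crossing tilt (hypothesis (A)) tested on `a P + b Q`: for profiles `eP`, `eQ` on the kept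
layers and a crossing profile `0 ≤ w ≤ β`,
`Ψ(eQ ∘ r + eP + w)² ≤ Ψ(eP ∘ r + eP + w) · Ψ(eQ ∘ r + eQ + w)`, where `r` is the site part of the
plaquette reflection and `Ψ(e) = E_β exp(-∑ₓ e(x) Re tr ρ(U_{(x,o)}))`. -/
theorem schwarz_profiles :
    ∀ {S N : ℕ} {G : Type} [Group G] [TopologicalSpace G] [IsTopologicalGroup G] [CompactSpace G]
      [MeasurableSpace G] [BorelSpace G] (ρ : G →* Matrix (Fin N) (Fin N) ℂ)
      (o : {q : Fin 4 × Fin 4 // q.1 < q.2}),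
    (∀ (d L N : ℕ) [NeZero d] [NeZero L] (G : Type) [Group G] [TopologicalSpace G]
      [IsTopologicalGroup G] [CompactSpace G] [MeasurableSpace G] [BorelSpace G]
      (ρ : G →* Matrix (Fin N) (Fin N) ℂ), Odd L → 3 ≤ L → Continuous ρ →
      ∀ (β : ℝ), 0 ≤ β → ∀ (t : Plaquette d L → ℝ), (∀ p, 0 ≤ t p) → (∀ p, t p ≤ β) →
      ∀ (F : GaugeConfig d L G → ℂ), Measurable F → (∃ C : ℝ, ∀ U, ‖F U‖ ≤ C) →
        DependsOn F (↑(WilsonOddRP.oPosEdges ∪ WilsonOddRP.oSharedEdges : Finset (Edge d L))) →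
        0 ≤ wilsonExpectation ρ β (fun U : GaugeConfig d L G =>
          (starRingEnd ℂ) (F U.timeReflect) * F U *
            ((Real.exp (-∑ p ∈ Finset.univ.filter WilsonOddRP.IsOCrossPlaq,
                t p * WilsonRP.plaqRe ρ U p) : ℝ) : ℂ))) →
    1 ≤ S → Continuous ρ → ∀ {β : ℝ}, 0 ≤ β → ∀ (eP eQ w : Site 4 (2 * S + 1) → ℝ),
    (∀ x, eP x ≠ 0 → (1 ≤ (x 0).val ∧ (x 0).val ≤ S) ∨ (o.1.1 ≠ 0 ∧ (x 0).val = S + 1)) →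
    (∀ x, eQ x ≠ 0 → (1 ≤ (x 0).val ∧ (x 0).val ≤ S) ∨ (o.1.1 ≠ 0 ∧ (x 0).val = S + 1)) →
    (∀ x, w x ≠ 0 → WilsonOddRP.IsOCrossPlaq (x, o)) → (∀ x, 0 ≤ w x) → (∀ x, w x ≤ β) →
    (∫ U, Real.exp (-∑ x, (eQ (WilsonRP.plaqReflect (x, o)).1 + eP x + w x) *
        WilsonRP.plaqRe ρ U (x, o)) ∂(wilsonMeasure ρ β : Measure (GaugeConfig 4 (2 * S + 1) G)))
        ^ 2 ≤
      (∫ U, Real.exp (-∑ x, (eP (WilsonRP.plaqReflect (x, o)).1 + eP x + w x) *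
        WilsonRP.plaqRe ρ U (x, o)) ∂(wilsonMeasure ρ β : Measure (GaugeConfig 4 (2 * S + 1) G))) *
      (∫ U, Real.exp (-∑ x, (eQ (WilsonRP.plaqReflect (x, o)).1 + eQ x + w x) *
        WilsonRP.plaqRe ρ U (x, o)) ∂(wilsonMeasure ρ β : Measure (GaugeConfig 4 (2 * S + 1) G))) := by
  intro S N G _ _ _ _ _ _ ρ o hRP hS hρ β hβ eP eQ w heP heQ hw hw0 hwβ
  haveI : Fact (1 < 2 * S + 1) := ⟨by omega⟩
  set μ := (wilsonMeasure ρ β : Measure (GaugeConfig 4 (2 * S + 1) G)) with hμ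
  -- integrability of the tilt functionals
  have hi : ∀ (k : ℂ) (e : Site 4 (2 * S + 1) → ℝ), Integrable (fun U : GaugeConfig 4 (2 * S + 1) G =>
      k * ((Real.exp (-∑ x, e x * WilsonRP.plaqRe ρ U (x, o)) : ℝ) : ℂ)) μ :=
    fun k e => (integrable_exp_sum ρ o hρ β e).const_mul k
  -- products of three tilt functionals
  have hg : ∀ (e₁ e₂ e₃ : Site 4 (2 * S + 1) → ℝ) (U : GaugeConfig 4 (2 * S + 1) G),
      Real.exp (-∑ x, (e₁ x + e₂ x + e₃ x) * WilsonRP.plaqRe ρ U (x, o)) =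
        Real.exp (-∑ x, e₁ x * WilsonRP.plaqRe ρ U (x, o)) *
          Real.exp (-∑ x, e₂ x * WilsonRP.plaqRe ρ U (x, o)) *
          Real.exp (-∑ x, e₃ x * WilsonRP.plaqRe ρ U (x, o)) := fun e₁ e₂ e₃ U => by
    rw [exp_sum_mul_exp_sum, exp_sum_mul_exp_sum]
  refine sq_le_mul_of_form (c' := ∫ U, Real.exp (-∑ x,
    (eP (WilsonRP.plaqReflect (x, o)).1 + eQ x + w x) * WilsonRP.plaqRe ρ U (x, o)) ∂μ) fun a b => ?_
  -- reflection positivity with the crossing tilt `w`, tested on `a P + b Q`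
  have h : 0 ≤ ∫ U, conj (a * ((Real.exp (-∑ x, eP x * WilsonRP.plaqRe ρ U.timeReflect (x, o)) : ℝ) : ℂ)
      + b * ((Real.exp (-∑ x, eQ x * WilsonRP.plaqRe ρ U.timeReflect (x, o)) : ℝ) : ℂ)) *
      (a * ((Real.exp (-∑ x, eP x * WilsonRP.plaqRe ρ U (x, o)) : ℝ) : ℂ)
        + b * ((Real.exp (-∑ x, eQ x * WilsonRP.plaqRe ρ U (x, o)) : ℝ) : ℂ)) *
      ((Real.exp (-∑ p ∈ Finset.univ.filter WilsonOddRP.IsOCrossPlaq,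
        (if p.2 = o then w p.1 else 0) * WilsonRP.plaqRe ρ U p) : ℝ) : ℂ) ∂μ := by
    refine hRP 4 (2 * S + 1) N G ρ (odd_two_mul_add_one S) (by omega) hρ β hβ
      (fun p => if p.2 = o then w p.1 else 0) (fun p => ?_) (fun p => ?_)
      (fun U => a * ((Real.exp (-∑ x, eP x * WilsonRP.plaqRe ρ U (x, o)) : ℝ) : ℂ)
        + b * ((Real.exp (-∑ x, eQ x * WilsonRP.plaqRe ρ U (x, o)) : ℝ) : ℂ)) ?_ ?_ ?_
    · split_ifs
      · exact hw0 _
      · exact le_rfl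
    · split_ifs
      · exact hwβ _
      · exact hβ
    · exact (measurable_const.mul (Complex.measurable_ofReal.comp (measurable_exp_sum ρ o hρ eP))).add
        (measurable_const.mul (Complex.measurable_ofReal.comp (measurable_exp_sum ρ o hρ eQ)))
    · refine ⟨‖a‖ * Real.exp (∑ x, |eP x| * N) + ‖b‖ * Real.exp (∑ x, |eQ x| * N), fun U =>
        (norm_add_le _ _).trans (add_le_add ?_ ?_)⟩
      · rw [norm_mul, Complex.norm_of_nonneg (Real.exp_pos _).le]
        exact mul_le_mul_of_nonneg_left (exp_sum_le ρ o hρ eP U) (norm_nonneg _)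
      · rw [norm_mul, Complex.norm_of_nonneg (Real.exp_pos _).le]
        exact mul_le_mul_of_nonneg_left (exp_sum_le ρ o hρ eQ U) (norm_nonneg _)
    · intro U V hUV
      show a * _ + b * _ = a * _ + b * _
      rw [exp_sum_congr ρ o hS eP heP hUV, exp_sum_congr ρ o hS eQ heQ hUV]
  -- expand the integrand into the four tilt functionals
  have hpt : ∀ U : GaugeConfig 4 (2 * S + 1) G,
      conj (a * ((Real.exp (-∑ x, eP x * WilsonRP.plaqRe ρ U.timeReflect (x, o)) : ℝ) : ℂ)
        + b * ((Real.exp (-∑ x, eQ x * WilsonRP.plaqRe ρ U.timeReflect (x, o)) : ℝ) : ℂ)) *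
      (a * ((Real.exp (-∑ x, eP x * WilsonRP.plaqRe ρ U (x, o)) : ℝ) : ℂ)
        + b * ((Real.exp (-∑ x, eQ x * WilsonRP.plaqRe ρ U (x, o)) : ℝ) : ℂ)) *
      ((Real.exp (-∑ p ∈ Finset.univ.filter WilsonOddRP.IsOCrossPlaq,
        (if p.2 = o then w p.1 else 0) * WilsonRP.plaqRe ρ U p) : ℝ) : ℂ) =
      conj a * a * ((Real.exp (-∑ x, (eP (WilsonRP.plaqReflect (x, o)).1 + eP x + w x) *
          WilsonRP.plaqRe ρ U (x, o)) : ℝ) : ℂ)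
      + conj b * a * ((Real.exp (-∑ x, (eQ (WilsonRP.plaqReflect (x, o)).1 + eP x + w x) *
          WilsonRP.plaqRe ρ U (x, o)) : ℝ) : ℂ)
      + conj a * b * ((Real.exp (-∑ x, (eP (WilsonRP.plaqReflect (x, o)).1 + eQ x + w x) *
          WilsonRP.plaqRe ρ U (x, o)) : ℝ) : ℂ)
      + conj b * b * ((Real.exp (-∑ x, (eQ (WilsonRP.plaqReflect (x, o)).1 + eQ x + w x) *
          WilsonRP.plaqRe ρ U (x, o)) : ℝ) : ℂ) := by
    intro U
    rw [sum_cross_tilt ρ o w hw U, sum_plaqRe_timeReflect ρ o hρ eP U,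
      sum_plaqRe_timeReflect ρ o hρ eQ U, hg, hg, hg, hg]
    simp only [map_add, map_mul, Complex.conj_ofReal]
    push_cast
    ring
  rw [integral_congr_ae (ae_of_all _ hpt), integral_add4 (hi _ _) (hi _ _) (hi _ _) (hi _ _),
    integral_const_mul, integral_const_mul, integral_const_mul, integral_const_mul,
    integral_complex_ofReal, integral_complex_ofReal, integral_complex_ofReal,
    integral_complex_ofReal] at h
  exact h

end Summit.QuantumFields.YangMills.Cruxes.LatticeGapOnTrajectory.SparseDefectOrbitWindow

end
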